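import Summits.PneNP.PneNP.Theorems.ConvexRankGatesConvexGateBlindXorDefs
import Summits.PneNP.PneNP.Theorems.ConvexRankGatesConvexGateBlindStubPerfectCompletenessMain

/-!
# Stub `stub_perfectCompleteness` of line `xor-door-perfect-completeness` (crux `ConvexGateBlind`,
item stmt-PneNP-10680): perfect completeness of SA+SOS at every degree

`PerfectCompleteness` (shared vocabulary of the line, `…XorDefs`): for every degree `d` there is an
UNSATISFIABLE 3-sparse XOR system `F` with a degree-`d` perfect-completeness Sherali–Adams + SOS
pseudo-expectation (`HasPerfectPseudoExp d F`). This file only folds the shared definitions back into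
the definition-free assembled theorem `PC.stub_perfectCompleteness_main` of `…StubPerfectCompletenessMain`
(Tseitin contradiction on the `(6d+6) × (6d+6)` honeycomb torus + Grigoriev's functional; Grigoriev,
*Theoret. Comput. Sci.* 259 (2001) 613–622; Schoenebeck, FOCS 2008, Thm 1): the violation count
`viol F` is the sum of the per-equation violation indicators.
-/

set_option linter.dupNamespace false -- `Summit.PneNP.PneNP.…`: summit = sub-problem (D-0017)

namespace Summit.PneNP.PneNP.Theorems.XorDoor

open Finset

noncomputable section


/-- The violation count as the sum of the per-equation violation indicators. [folklore] -/
theorem viol_eq_sum_indicator {m : ℕ} (F : Finset (Pool m)) :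
    (fun y => (viol F y : ℝ)) =
      ∑ e ∈ F, fun y => if y e.1 + y e.2.1 + y e.2.2.1 = e.2.2.2 then (0 : ℝ) else 1 := by
  funext y
  rw [Finset.sum_apply, viol, Finset.card_filter]
  push_cast
  refine sum_congr rfl fun e _ => ?_
  by_cases h : y e.1 + y e.2.1 + y e.2.2.1 = e.2.2.2 <;> simp [Sat, h]

/-- **Stub `stub_perfectCompleteness`** (perfect completeness of SA+SOS at every degree; Grigoriev 2001,
Schoenebeck 2008, here for the Tseitin contradiction on the honeycomb torus): folds the shared
definitions into `PC.stub_perfectCompleteness_main`. [folklore] -/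
theorem stub_perfectCompleteness : PerfectCompleteness := by
  intro d
  obtain ⟨m, F, hunsat, E, h1, h2, h3, h4⟩ := PC.stub_perfectCompleteness_main d
  refine ⟨m, F, hunsat, E, fun h hj hpos => h1 h hj hpos, fun s hs => h2 s hs, h3, ?_⟩
  rw [viol_eq_sum_indicator F, map_sum]
  exact Finset.sum_eq_zero fun e he => h4 e he

end

end Summit.PneNP.PneNP.Theorems.XorDoor
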